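import Literature.Analysis.FluidPDE.AlbrittonBlowupCriterionKatoHalves
import Literature.Analysis.FluidPDE.AlbrittonSingularPointReduction
import Literature.Analysis.FluidPDE.AlbrittonKatoClassIntegralForm
import HarnessLib

/-!
# Albritton's Corollary 4.6 over Albritton's class: maximality from Thm. 4.2 (i) and the
architecture of Prop. 4.5

Analysis/FluidPDE proof file (no definition, no named fact; nothing accepted is restated or
changed) next to `Literature.Analysis.FluidPDE.albritton_singular_point_of_blowup`
(`AlbrittonBlowupCriterion.lean`), the tree's rendering of D. Albritton, *Blow-up criteria for the
Navier–Stokes equations in non-endpoint critical Besov spaces*, Anal. PDE 11 (2018) 1415–1456 =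
arXiv:1612.04439, **Cor. 4.6**, and to `AlbrittonBlowupCriterionKatoHalves.lean`, which writes the
corrected statement of that corollary over Albritton's own class verbatim as a hypothesis `h`. It
records the verdict of the fact's prove seat (2026-08-15) — **mis-stated: stated stronger than its
source** — and proves, over the faithful class, the two pieces of the printed argument that are
class-level bookkeeping: maximality at an `L^∞` blow-up time (Thm. 4.2 (i)) and the reduction of
Cor. 4.6 to the `L^∞` continuation and the far-field bound (proof of Prop. 4.5).

## What is printed (arXiv:1612.04439)

* **Cor. 4.6**: "Let `u` be the mild solution of Theorem 4.2 with initial data `u₀`. If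
  `T*(u₀) < ∞`, then `u` has a singular point at time `T*(u₀)`."
* **Thm. 4.2** (mild solutions in critical Besov spaces, §4.3): for `3 < p, q < ∞` and
  divergence-free `u₀ ∈ Ḃ^{s_p}_{p,q}(ℝ³)`, `s_p = -1 + 3/p`, there are `0 < T*(u₀) ≤ ∞` and a mild
  solution `u` (of the Oseen integral equation `u(t) = e^{tΔ}u₀ - ∫₀ᵗ e^{(t-s)Δ} ℙ∇·(u ⊗ u) ds`) with
  `u ∈ C([0,T]; Ḃ^{s_p}_{p,q}) ∩ L̃¹_T Ḃ^{s_p+2}_{p,q} ∩ L̃^∞_T Ḃ^{s_p}_{p,q}` and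
  `u ∈ K̊_p(Q_T) ∩ K̊_∞(Q_T) ∩ C((0,T]; L^p ∩ L^∞)` for all `0 < T < T*(u₀)`; "`u` is the unique mild
  solution satisfying [the first] and the unique mild solution satisfying [the second]"; and, if
  `T*(u₀) < ∞`, (i) `lim_{t ↑ T*} ‖u(·,t)‖_{L^{p₀}} = ∞` for all `p₀ ∈ [p, ∞]`.
* **Prop. 4.5** (formation of singularity at blow-up time, `L^p` data, `3 < p < ∞`), from whose
  proof Cor. 4.6 follows at a time `t₀ > 0` where `u(t₀) ∈ L^p ∩ L^∞`; **§4.4**: "`z₀` is a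
  singular point of `u` if for all `0 < r < R`, `u ∉ L^∞(Q(z₀, r))`",
  `Q(z₀, R) = B(x₀, R) × (t₀ - R², t₀)`.

## The verdict on `albritton_singular_point_of_blowup`: mis-stated

It quantifies over `IsMaximalBesovMildSolution (-1+3/p) p q T ν u U` (`CriticalRegularity.lean`):
*every* duality-form mild solution in `C([0,T); Ḃ^{s_p}_{p,q}) ∩ K̊_∞` with no extension *in that
class*. That class is neither of the two uniqueness classes of Thm. 4.2 (it asks no `K̊_p`, no
`C((0,T); L^p ∩ L^∞)`, no `L̃¹_T Ḃ^{s_p+2}_{p,q}` control) nor a published one — see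
`CriticalRegularity.lean`, §Verdict clean-up (continuity in the critical Besov space alone is not a
uniqueness class, Fujii 2026, Thm. 1.2 (N2); Kato-type uniqueness needs an `L^p`-weight at `t = 0`,
Miura 2005, Thm. 2.3), where the parent `albritton_besov_blowup` (Thm. 1.1) was deprecated as
mis-stated on 2026-08-15 for exactly this reason, and `AlbrittonBlowupCriterionKato.lean`, §The
discrepancy. Since `NS(u₀)` with `T*(u₀) < ∞` *is* maximal in the tree's sense (Thm. 4.2 (i) with
`p₀ = ∞`; `albritton_singular_point_of_blowup.exists_singular_of_tendsto_eLpNorm_top`,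
`AlbrittonBlowupCriterionKatoHalves.lean`), the old `Prop` implies the printed corollary and asserts
it, in addition, for every unidentified member of the larger class: it is the printed statement
**plus** the unprinted identification `hId` "every `IsBesovMildSolutionOn` solution lies in
Albritton's class" (machine-checked: `albritton_singular_point_of_blowup_iff_katoClass`,
`AlbrittonBlowupCriterionKatoHalves.lean`). Equivalently (`AlbrittonSingularPointReduction.lean`,
`continuation_of_bounded_of_albritton_singular_point`), the old `Prop` contains the `L^∞`
continuation principle for the whole class `IsBesovMildSolutionOn`, whose printed proof (restart
from `u(t₀) ∈ L^p ∩ L^∞` and gluing, Lemma 4.4) uses the `K̊_p` integrability of the Duhamel term at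
`t = 0⁺` that the tree's class does not record. Nothing asserts that the old `Prop` is false; it is
kept verbatim (its conditional users are `AlbrittonSingularPointReduction.lean` and
`AlbrittonBlowupCriterionKatoHalves.lean`).

## The corrected statement (not declared here)

"The mild solution of Theorem 4.2 with `T*(u₀) < ∞`, on `[0, T*)`" is rendered by
`IsMaximalKatoBesovMildSolution p q T ν u U` with `0 < T` (`AlbrittonBlowupCriterionKato.lean`): the
tree's Besov mild class intersected with the second uniqueness class of Thm. 4.2,
`K̊_p ∩ K̊_∞ ∩ C((0,T); L^p ∩ L^∞)` (on which the Duhamel integrands are absolutely integrable,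
`‖u(τ)‖_{L^p} ‖u(τ)‖_{L^∞} ≲ τ^{-1+3/(2p)}`), with no extension in that class. By the uniqueness of
Thm. 4.2 a member on `[0, T)` is `NS(u 0)` there with `T ≤ T*(u 0)`, and "no extension" says
`T = T*(u 0)`: for `T < T*` the solution itself extends, while no member of the class extends
`NS(u₀)` past `T* < ∞`, its `K̊_∞` bound being incompatible with (i)
(`IsKatoBesovMildSolutionOn.isMaximalKatoBesovMildSolution_of_tendsto_eLpNorm_top` below). The
corrected statement — Cor. 4.6 as printed, for every viscosity `ν > 0` (Albritton takes `ν = 1`;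
apply the printed statement to `w(s, y) = ν⁻¹ u(s/ν, y)`, which preserves the class; cylinders scale
by `√ν` in time) and function-valued solutions seen through their distributions `U`, singular
points as in §4.4 with the backward cylinders `parabolicCylinder r (T, x₀) = (T - r², T) × B(x₀, r)`
inside the strip `(0, T) × ℝ³` — is the hypothesis `h` of
`albritton_singular_point_of_blowup_of_katoClass` (`AlbrittonBlowupCriterionKatoHalves.lean`),
repeated verbatim as hypothesis / conclusion of the theorems below. As a named fact it would read

    -- [cite: Albritton2018, Cor. 4.6 (with Thm. 4.2, Prop. 4.5 and §4.4)]
    def albritton_singular_point_of_blowup_katoClass : Prop :=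
      ∀ {ν : ℝ} (_hν : 0 < ν) {p q : ℝ≥0∞} [Fact (1 ≤ p)] (_hp₃ : 3 < p) (_hp : p < ∞)
        (_hq₃ : 3 < q) (_hq : q < ∞) {T : ℝ} (_hT : 0 < T) {u : ℝ → ℝ³ → ℝ³}
        {U : ℝ → 𝓢'(ℝ³, ℂ³)} (_hmax : IsMaximalKatoBesovMildSolution p q T ν u U),
        ∃ x₀ : ℝ³, ∀ r : ℝ, 0 < r → r ^ 2 < T →
          eLpNorm (uncurry u) ∞ (volume.restrict (parabolicCylinder r ((T : ℝ), x₀))) = ∞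

and is **not** declared by this file: under D-0026 a proving seat may not mint a new unproved fact
(`lint.fact-fanout`); it is left, with this text, to a cite/definition item or the operator path,
exactly as `CriticalRegularity.lean` leaves `albritton_besov_blowup_pathSpace`. The first uniqueness
class of Thm. 4.2 (GKP's path space; `IsMaximalGKPSolution`, `GKPCriticalElements.lean`) gives an
equivalent reading by Thm. 4.2 (the solution lies in both classes and is unique in each); that
bridge is not in the tree and is not asserted here.

## What this file proves

* `IsKatoBesovMildSolutionOn.isMaximalKatoBesovMildSolution_of_tendsto_eLpNorm_top` — a member of
  Albritton's class on `[0, T)`, `0 < T`, with `‖u(t)‖_{L^∞} → ∞` as `t ↑ T` (Thm. 4.2 (i)) is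
  maximal in Albritton's class (an extension is one in the tree's class, excluded by
  `IsBesovMildSolutionOn.isMaximalBesovMildSolution_of_tendsto_eLpNorm_top`);
* `katoClass_exists_singular_of_tendsto_eLpNorm_top` — the corrected statement read with
  Thm. 4.2 (i): under it such a solution has a singular point `(T, x₀)`;
* the printed architecture of Prop. 4.5 over the faithful class, for the eventual discharge of the
  corrected statement: `katoClass_singular_point_of_continuation` — it follows from (B) the `L^∞`
  continuation of members of Albritton's class bounded on a final strip `(T - δ, T) × ℝ³` (Prop. 4.5,
  last step: the bilinear estimates in `L^∞_t L^p_x × L^∞` and the propagation Lemma 4.4 in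
  `X = L^∞`, `E = X ∩ L^∞_t L^p_x`, restart from `u(t₀) ∈ L^p ∩ L^∞`) and (C) the far-field bound
  (Calderón splitting, energy class of the remainder, `ε`-regularity Thm. 4.8: "`sup_K |u| < κ`,
  `K = (ℝ³ ∖ B(R)) × (T*/2, T*)`"), both written inline as hypotheses (no named fact, D-0026),
  glued by the compactness of `B̄(0, R)` (`exists_pos_eLpNorm_lt_top_of_forall_exists_cylinder`),
  exactly as `albritton_singular_point_of_blowup_of_continuation` does it over the tree's class; and
  conversely `katoClass_continuation_of_bounded_of_singular_point` (the corrected statement gives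
  back (B)), so that, given (C), the corrected Cor. 4.6 is *equivalent* to the `L^∞` continuation
  principle in Albritton's class — where, unlike in the tree's class, the restart data
  `u(t₀) ∈ L^p ∩ L^∞` and the `K̊_p` control of the Duhamel term that the printed proof uses are
  available.

## References

* D. Albritton, Anal. PDE 11 (2018) 1415–1456 = arXiv:1612.04439 (held as
  `paper:arxiv-1612.04439`): Cor. 4.6; Prop. 4.5 and its proof; Thm. 4.2 (the two uniqueness
  classes and (i)) with Steps 2–4 of its proof; Lemma 4.4; §4.4 (singular points, Thm. 4.8); §3,
  Step 1 (the use of Cor. 4.6 in the proof of Thm. 1.1). [Albritton2018]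
* M. Fujii, arXiv:2602.19846 (2026), Thm. 1.2 (N2); H. Miura, J. Funct. Anal. 218 (2005) 110–129,
  Thm. 2.3 — as cited in `CriticalRegularity.lean`, §Verdict clean-up.
* W. Rusin, V. Šverák, J. Funct. Anal. 260 (2011) = arXiv:0911.0500, §4; P. G. Lemarié-Rieusset,
  *The Navier–Stokes Problem in the 21st Century* (2016), Thm. 15.1 (C) (the same architecture for
  `L^p` / `L³` data).
-/

noncomputable section

open MeasureTheory TemperedDistribution Set Function Filter Metric
open _root_.Topology
open scoped SchwartzMap ENNReal NNReal

namespace Literature.Analysis.FluidPDE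

/-! ### `L^∞` blow-up at `T` makes a member of Albritton's class maximal in that class -/

/-- **`L^∞` blow-up at `T` ⇒ maximal in Albritton's class.** A member `(u, U)` of Albritton's
class on `[0, T)`, `0 < T`, with `‖u(t)‖_{L^∞} → ∞` as `t ↑ T` — Thm. 4.2 (i) with `p₀ = ∞` for
`NS(u₀)` at `T = T*(u₀) < ∞` — has no extension in Albritton's class past `T`: an extension would
be one in the tree's class, which `IsBesovMildSolutionOn.isMaximalBesovMildSolution_of_tendsto_eLpNorm_top`
(`AlbrittonBlowupCriterionPathSpace.lean`: its `K_∞` bound keeps `‖u(t)‖_∞` bounded near `T`)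
excludes. This is the printed "`T*(u₀)` is the maximal time of existence" read in the tree's
vocabulary. [cite: Albritton2018, Thm. 4.2 (i) and Step 4 of its proof] -/
theorem IsKatoBesovMildSolutionOn.isMaximalKatoBesovMildSolution_of_tendsto_eLpNorm_top
    {p q : ℝ≥0∞} [Fact (1 ≤ p)] {T ν : ℝ} {u : ℝ → EuclideanSpace ℝ (Fin 3) → EuclideanSpace ℝ (Fin 3)} {U : ℝ → 𝓢'(EuclideanSpace ℝ (Fin 3), EuclideanSpace ℂ (Fin 3))}
    (hu : IsKatoBesovMildSolutionOn p q T ν u U) (hT : 0 < T)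
    (hblow : Tendsto (fun t => eLpNorm (u t) ∞ volume) (𝓝[<] T) (𝓝 ∞)) :
    IsMaximalKatoBesovMildSolution p q T ν u U where
  isKatoBesovMildSolutionOn := hu
  not_extendable := by
    rintro ⟨T', hT', v, V, hv, hvu⟩
    exact (hu.isBesovMildSolutionOn.isMaximalBesovMildSolution_of_tendsto_eLpNorm_top hT
      hblow).not_extendable ⟨T', hT', v, V, hv.isBesovMildSolutionOn, hvu⟩

/-- **The corrected Cor. 4.6 read with Thm. 4.2 (i).** Assume Cor. 4.6 over Albritton's class
(hypothesis `h`, the corrected statement of `albritton_singular_point_of_blowup`, verbatim the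
hypothesis `h` of `albritton_singular_point_of_blowup_of_katoClass`; module docstring). A member
`(u, U)` of Albritton's class on `[0, T)`, `0 < T`, `3 < p, q < ∞`, `ν > 0`, with
`‖u(t)‖_{L^∞} → ∞` as `t ↑ T` — which is what Thm. 4.2 (i) (`p₀ = ∞`) prints for `NS(u₀)` at
`T = T*(u₀) < ∞` — is maximal in Albritton's class
(`IsKatoBesovMildSolutionOn.isMaximalKatoBesovMildSolution_of_tendsto_eLpNorm_top`), hence has a
singular point `(T, x₀)`. [cite: Albritton2018, Cor. 4.6 (with Thm. 4.2 (i))] -/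
theorem katoClass_exists_singular_of_tendsto_eLpNorm_top
    (h : ∀ ⦃ν : ℝ⦄, 0 < ν → ∀ ⦃p q : ℝ≥0∞⦄ [Fact (1 ≤ p)], 3 < p → p < ∞ → 3 < q → q < ∞ →
      ∀ ⦃T : ℝ⦄, 0 < T → ∀ ⦃u : ℝ → EuclideanSpace ℝ (Fin 3) → EuclideanSpace ℝ (Fin 3)⦄ ⦃U : ℝ → 𝓢'(EuclideanSpace ℝ (Fin 3), EuclideanSpace ℂ (Fin 3))⦄,
        IsMaximalKatoBesovMildSolution p q T ν u U →
        ∃ x₀ : EuclideanSpace ℝ (Fin 3), ∀ r : ℝ, 0 < r → r ^ 2 < T →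
          eLpNorm (uncurry u) ∞ (volume.restrict (parabolicCylinder r ((T : ℝ), x₀))) = ∞)
    {ν : ℝ} (hν : 0 < ν) {p q : ℝ≥0∞} [Fact (1 ≤ p)] (hp₃ : 3 < p) (hp : p < ∞) (hq₃ : 3 < q)
    (hq : q < ∞) {T : ℝ} (hT : 0 < T) {u : ℝ → EuclideanSpace ℝ (Fin 3) → EuclideanSpace ℝ (Fin 3)} {U : ℝ → 𝓢'(EuclideanSpace ℝ (Fin 3), EuclideanSpace ℂ (Fin 3))}
    (hu : IsKatoBesovMildSolutionOn p q T ν u U)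
    (hblow : Tendsto (fun t => eLpNorm (u t) ∞ volume) (𝓝[<] T) (𝓝 ∞)) :
    ∃ x₀ : EuclideanSpace ℝ (Fin 3), ∀ r : ℝ, 0 < r → r ^ 2 < T →
      eLpNorm (uncurry u) ∞ (volume.restrict (parabolicCylinder r ((T : ℝ), x₀))) = ∞ :=
  h hν hp₃ hp hq₃ hq hT (hu.isMaximalKatoBesovMildSolution_of_tendsto_eLpNorm_top hT hblow)

/-! ### The printed architecture of Prop. 4.5 over Albritton's class -/

/-- **Cor. 4.6 over Albritton's class from the `L^∞` continuation and the far-field bound**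
(Albritton 2018, proof of Prop. 4.5 ⟹ Cor. 4.6). Hypotheses, written inline (no named fact):
`hB` — *continuation*: a member of Albritton's class on `[0, T)`, `3 < p, q < ∞`, `0 < T`,
essentially bounded on a final strip `(T - δ, T) × ℝ³`, `δ > 0`, is extended by a member of the
class on some `[0, T')`, `T' > T`, agreeing with it a.e. at every time of `[0, T)` (the last step of
the proof of Prop. 4.5: the bilinear estimates
`‖B(v,w)‖_{L^∞_t L^p_x(Q_T)} ≤ c T^{1/2} ‖v‖_{L^∞_t L^p_x} ‖w‖_{L^∞}` and Lemma 4.4 in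
`X = L^∞(Q_{t₀,T*})`, `E = X ∩ L^∞_t L^p_x`, "This prevents `‖u(·,t)‖_{L^p}` from becoming unbounded
as `t ↑ T*`", with the subcritical `L^p` theory and Thm. 4.2 (i)); `hC` — *far field*: a member of
the class on `[0, T)`, `0 < T`, is essentially bounded on `(T - δ, T) × B̄(0, R)ᶜ` for some `δ > 0`,
`R` (Calderón's splitting `u₀ = U₀ + V₀`, the energy class of the remainder up to `T*`, the decay of
`∫∫_{B(x,1)} |u|³ + |p|^{3/2}` and the `ε`-regularity Thm. 4.8: "`sup_K |u(x,t)| < κ`,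
`K := (ℝ³ ∖ B(R)) × (T*/2, T*)`"). Conclusion: the corrected statement of Cor. 4.6 (verbatim the
hypothesis `h` of `albritton_singular_point_of_blowup_of_katoClass`). Proof, as printed: if no `x₀`
were singular, every `x₀` carries a bounded cylinder `Q_r(T, x₀)`; with `hC` and the compactness of
`B̄(0, R)` (`exists_pos_eLpNorm_lt_top_of_forall_exists_cylinder`) `u ∈ L^∞((T - δ, T) × ℝ³)`
("implies that `u ∈ L^∞(Q_{ε,T*})`"), so by `hB` the solution continues past `T` in the class —
against maximality. Twin of `albritton_singular_point_of_blowup_of_continuation`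
(`AlbrittonSingularPointReduction.lean`) over the faithful class.
[cite: Albritton2018, Prop. 4.5 (proof) and Cor. 4.6] -/
theorem katoClass_singular_point_of_continuation
    (hB : ∀ {ν : ℝ} (_ : 0 < ν) {p q : ℝ≥0∞} [Fact (1 ≤ p)] (_ : 3 < p) (_ : p < ∞)
      (_ : 3 < q) (_ : q < ∞) {T : ℝ} (_ : 0 < T) {δ : ℝ} (_ : 0 < δ) {u : ℝ → EuclideanSpace ℝ (Fin 3) → EuclideanSpace ℝ (Fin 3)}
      {U : ℝ → 𝓢'(EuclideanSpace ℝ (Fin 3), EuclideanSpace ℂ (Fin 3))} (_ : IsKatoBesovMildSolutionOn p q T ν u U)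
      (_ : eLpNorm (uncurry u) ∞ (volume.restrict (Ioo (T - δ) T ×ˢ (univ : Set (EuclideanSpace ℝ (Fin 3))))) < ∞),
      ∃ T' > T, ∃ (v : ℝ → EuclideanSpace ℝ (Fin 3) → EuclideanSpace ℝ (Fin 3)) (V : ℝ → 𝓢'(EuclideanSpace ℝ (Fin 3), EuclideanSpace ℂ (Fin 3))),
        IsKatoBesovMildSolutionOn p q T' ν v V ∧ ∀ t ∈ Ico 0 T, v t =ᵐ[volume] u t)
    (hC : ∀ {ν : ℝ} (_ : 0 < ν) {p q : ℝ≥0∞} [Fact (1 ≤ p)] (_ : 3 < p) (_ : p < ∞)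
      (_ : 3 < q) (_ : q < ∞) {T : ℝ} (_ : 0 < T) {u : ℝ → EuclideanSpace ℝ (Fin 3) → EuclideanSpace ℝ (Fin 3)} {U : ℝ → 𝓢'(EuclideanSpace ℝ (Fin 3), EuclideanSpace ℂ (Fin 3))}
      (_ : IsKatoBesovMildSolutionOn p q T ν u U),
      ∃ δ : ℝ, 0 < δ ∧ ∃ R : ℝ, eLpNorm (uncurry u) ∞
        (volume.restrict (Ioo (T - δ) T ×ˢ (closedBall (0 : EuclideanSpace ℝ (Fin 3)) R)ᶜ)) < ∞)
    ⦃ν : ℝ⦄ (hν : 0 < ν) ⦃p q : ℝ≥0∞⦄ [Fact (1 ≤ p)] (hp₃ : 3 < p) (hp : p < ∞) (hq₃ : 3 < q)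
    (hq : q < ∞) ⦃T : ℝ⦄ (hT : 0 < T) ⦃u : ℝ → EuclideanSpace ℝ (Fin 3) → EuclideanSpace ℝ (Fin 3)⦄ ⦃U : ℝ → 𝓢'(EuclideanSpace ℝ (Fin 3), EuclideanSpace ℂ (Fin 3))⦄
    (hmax : IsMaximalKatoBesovMildSolution p q T ν u U) :
    ∃ x₀ : EuclideanSpace ℝ (Fin 3), ∀ r : ℝ, 0 < r → r ^ 2 < T →
      eLpNorm (uncurry u) ∞ (volume.restrict (parabolicCylinder r ((T : ℝ), x₀))) = ∞ := by
  by_contra hcon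
  push Not at hcon
  -- the far-field bound and a bounded cylinder at every `x` give a bounded final strip
  obtain ⟨δ₀, hδ₀, R, hfar⟩ := hC hν hp₃ hp hq₃ hq hT hmax.isKatoBesovMildSolutionOn
  obtain ⟨δ, hδ, hbd⟩ := exists_pos_eLpNorm_lt_top_of_forall_exists_cylinder hδ₀ hfar fun x => by
    obtain ⟨r, hr, -, hne⟩ := hcon x
    exact ⟨r, hr, lt_top_iff_ne_top.2 hne⟩
  -- continuation past `T` inside the class, contradicting the maximality of the lifespan
  obtain ⟨T', hT', v, V, hv, hvu⟩ := hB hν hp₃ hp hq₃ hq hT hδ hmax.isKatoBesovMildSolutionOn hbd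
  exact hmax.not_extendable ⟨T', hT', v, V, hv, hvu⟩

/-- **The corrected Cor. 4.6 gives back the `L^∞` continuation in Albritton's class** (Cor. 4.6
over Albritton's class — hypothesis `h`, verbatim the hypothesis `h` of
`albritton_singular_point_of_blowup_of_katoClass` — read contrapositively, with Thm. 4.2 (i)): if a
member `(u, U)` of Albritton's class on `[0, T)`, `0 < T`, `3 < p, q < ∞`, is essentially bounded
on a strip `(T - δ, T) × ℝ³`, `δ > 0`, then every cylinder `Q_r(T, x₀)` with `r² ≤ δ` lies in the
strip (`parabolicCylinder_subset_final_strip`), so no `(T, x₀)` is singular, the lifespan `T` is not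
maximal in the class, and some member of the class on a longer `[0, T')` agrees with `u` a.e. on
`[0, T)`. With `katoClass_singular_point_of_continuation`: given the far-field bound, the corrected
Cor. 4.6 and the continuation statement are equivalent. Twin of
`continuation_of_bounded_of_albritton_singular_point` (`AlbrittonSingularPointReduction.lean`).
[cite: Albritton2018, Cor. 4.6 and Thm. 4.2 (i)] -/
theorem katoClass_continuation_of_bounded_of_singular_point
    (h : ∀ ⦃ν : ℝ⦄, 0 < ν → ∀ ⦃p q : ℝ≥0∞⦄ [Fact (1 ≤ p)], 3 < p → p < ∞ → 3 < q → q < ∞ →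
      ∀ ⦃T : ℝ⦄, 0 < T → ∀ ⦃u : ℝ → EuclideanSpace ℝ (Fin 3) → EuclideanSpace ℝ (Fin 3)⦄ ⦃U : ℝ → 𝓢'(EuclideanSpace ℝ (Fin 3), EuclideanSpace ℂ (Fin 3))⦄,
        IsMaximalKatoBesovMildSolution p q T ν u U →
        ∃ x₀ : EuclideanSpace ℝ (Fin 3), ∀ r : ℝ, 0 < r → r ^ 2 < T →
          eLpNorm (uncurry u) ∞ (volume.restrict (parabolicCylinder r ((T : ℝ), x₀))) = ∞)
    {ν : ℝ} (hν : 0 < ν) {p q : ℝ≥0∞} [Fact (1 ≤ p)] (hp₃ : 3 < p) (hp : p < ∞) (hq₃ : 3 < q)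
    (hq : q < ∞) {T : ℝ} (hT : 0 < T) {δ : ℝ} (hδ : 0 < δ) {u : ℝ → EuclideanSpace ℝ (Fin 3) → EuclideanSpace ℝ (Fin 3)}
    {U : ℝ → 𝓢'(EuclideanSpace ℝ (Fin 3), EuclideanSpace ℂ (Fin 3))} (hu : IsKatoBesovMildSolutionOn p q T ν u U)
    (hbd : eLpNorm (uncurry u) ∞ (volume.restrict (Ioo (T - δ) T ×ˢ (univ : Set (EuclideanSpace ℝ (Fin 3))))) < ∞) :
    ∃ T' > T, ∃ (v : ℝ → EuclideanSpace ℝ (Fin 3) → EuclideanSpace ℝ (Fin 3)) (V : ℝ → 𝓢'(EuclideanSpace ℝ (Fin 3), EuclideanSpace ℂ (Fin 3))),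
      IsKatoBesovMildSolutionOn p q T' ν v V ∧ ∀ t ∈ Ico 0 T, v t =ᵐ[volume] u t := by
  by_contra hcon
  have hmax : IsMaximalKatoBesovMildSolution p q T ν u U := ⟨hu, hcon⟩
  obtain ⟨x₀, hx₀⟩ := h hν hp₃ hp hq₃ hq hT hmax
  -- an admissible radius: `ρ² < T` and `ρ² ≤ δ`
  set ρ : ℝ := min (Real.sqrt T / 2) (Real.sqrt δ) with hρ_def
  have hsqT : 0 < Real.sqrt T := Real.sqrt_pos.2 hT
  have hsqδ : 0 < Real.sqrt δ := Real.sqrt_pos.2 hδ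
  have hρ : 0 < ρ := lt_min (by positivity) hsqδ
  have hρT : ρ ^ 2 < T := by
    have h1 : ρ ≤ Real.sqrt T / 2 := min_le_left _ _
    have h2 : ρ ^ 2 ≤ (Real.sqrt T / 2) ^ 2 := pow_le_pow_left₀ hρ.le h1 2
    have h3 : (Real.sqrt T / 2) ^ 2 = T / 4 := by
      rw [div_pow, Real.sq_sqrt hT.le]; norm_num
    linarith
  have hρδ : ρ ^ 2 ≤ δ := by
    have h1 : ρ ≤ Real.sqrt δ := min_le_right _ _
    have h2 : ρ ^ 2 ≤ Real.sqrt δ ^ 2 := pow_le_pow_left₀ hρ.le h1 2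
    rwa [Real.sq_sqrt hδ.le] at h2
  -- the cylinder norm is infinite but dominated by the finite strip norm
  have hle : eLpNorm (uncurry u) ∞ (volume.restrict (parabolicCylinder ρ ((T : ℝ), x₀))) ≤
      eLpNorm (uncurry u) ∞ (volume.restrict (Ioo (T - δ) T ×ˢ (univ : Set (EuclideanSpace ℝ (Fin 3))))) :=
    eLpNorm_mono_measure _
      (Measure.restrict_mono (parabolicCylinder_subset_final_strip hρδ x₀) le_rfl)
  rw [hx₀ ρ hρ hρT, top_le_iff] at hle
  exact hbd.ne hle

/-! ### The corrected Cor. 4.6 from the far-field bound alone -/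

/-- **The corrected Cor. 4.6 reduced to the far-field bound** (Albritton 2018, Cor. 4.6 over
Albritton's class, with the `L^∞` continuation half — hypothesis `hB` of
`katoClass_singular_point_of_continuation` — now **proved**:
`albritton_continuation_katoClass`, `AlbrittonKatoClassIntegralForm.lean`). Granted the far-field
bound of members of Albritton's class near the final time (hypothesis `hC`: Prop. 4.5, proof,
(4.32)–(4.37): Calderón splitting, energy class of the remainder, ε-regularity), a maximal member
of Albritton's class with finite lifespan `T` has a singular point `(T, x₀)`.
[cite: Albritton2018, Cor. 4.6 with Prop. 4.5 (proof) and Thm. 4.2 (i)] -/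
theorem katoClass_singular_point_of_farField
    (hC : ∀ {ν : ℝ} (_ : 0 < ν) {p q : ℝ≥0∞} [Fact (1 ≤ p)] (_ : 3 < p) (_ : p < ∞)
      (_ : 3 < q) (_ : q < ∞) {T : ℝ} (_ : 0 < T) {u : ℝ → EuclideanSpace ℝ (Fin 3) → EuclideanSpace ℝ (Fin 3)} {U : ℝ → 𝓢'(EuclideanSpace ℝ (Fin 3), EuclideanSpace ℂ (Fin 3))}
      (_ : IsKatoBesovMildSolutionOn p q T ν u U),
      ∃ δ : ℝ, 0 < δ ∧ ∃ R : ℝ, eLpNorm (uncurry u) ∞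
        (volume.restrict (Ioo (T - δ) T ×ˢ (closedBall (0 : EuclideanSpace ℝ (Fin 3)) R)ᶜ)) < ∞)
    ⦃ν : ℝ⦄ (hν : 0 < ν) ⦃p q : ℝ≥0∞⦄ [Fact (1 ≤ p)] (hp₃ : 3 < p) (hp : p < ∞) (hq₃ : 3 < q)
    (hq : q < ∞) ⦃T : ℝ⦄ (hT : 0 < T) ⦃u : ℝ → EuclideanSpace ℝ (Fin 3) → EuclideanSpace ℝ (Fin 3)⦄ ⦃U : ℝ → 𝓢'(EuclideanSpace ℝ (Fin 3), EuclideanSpace ℂ (Fin 3))⦄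
    (hmax : IsMaximalKatoBesovMildSolution p q T ν u U) :
    ∃ x₀ : EuclideanSpace ℝ (Fin 3), ∀ r : ℝ, 0 < r → r ^ 2 < T →
      eLpNorm (uncurry u) ∞ (volume.restrict (parabolicCylinder r ((T : ℝ), x₀))) = ∞ := by
  by_contra hcon
  push Not at hcon
  -- the far-field bound and a bounded cylinder at every `x` give a bounded final strip
  obtain ⟨δ₀, hδ₀, R, hfar⟩ := hC hν hp₃ hp hq₃ hq hT hmax.isKatoBesovMildSolutionOn
  obtain ⟨δ, hδ, hbd⟩ := exists_pos_eLpNorm_lt_top_of_forall_exists_cylinder hδ₀ hfar fun x => by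
    obtain ⟨r, hr, -, hne⟩ := hcon x
    exact ⟨r, hr, lt_top_iff_ne_top.2 hne⟩
  -- continuation past `T` inside the class (now a theorem), contradicting maximality
  obtain ⟨T', hT', v, V, hv, hvu⟩ :=
    albritton_continuation_katoClass hν hp₃ hp hq₃ hq hT hδ hmax.isKatoBesovMildSolutionOn hbd
  exact hmax.not_extendable ⟨T', hT', v, V, hv, hvu⟩

end Literature.Analysis.FluidPDE

end
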